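import Summits.Ventures.HodgeRepro2.T6A3Main
import Summits.Ventures.HodgeRepro2.T6A1Complex

/-!
# T6-A3 — the bridge from A1's complex Weil projector to the model's (the (C3) binder of `A3_main`)

Tier 6 (README §10), sub-goal A3, seat t6-p3; proof lane.  A1 (t6-p1, `T6A1Complex`) delivers the
complex Weil projector `eC K P : H^*(B, ℂ) → H^*(B, ℂ)` characterised PIECE-WISE on `⋀⁴`: it is the
identity on the Weil pieces `H^{(4e_ρ)}` and zero on every other piece `H^{(k)}`
(`eC_coe_of_mem_piece`), with `eC ∘ extC = extC ∘ p_W` (`eC_extC`).  `A3_main` consumes the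
projector in MONOMIAL form (`hpW_C`: through the eigenbasis model, `eC` is `modelWeilProj weilSet`,
the six Weil coordinates kept and every other monomial coordinate killed).  This file proves the
two forms agree on `⋀⁴`: every model monomial `e_t` (a 4-set `t` of generators) is a product of
eigenvectors, hence lies in the piece of its type count; that type count is `4e_ρ` exactly when
`t` is a Weil index set.  Consequently `hpW_C` holds for `pW := A1's pW K P`, and `A3_main` composes
with A1's and A2's outputs.  Nothing here is a display.
-/

open scoped TensorProduct

namespace Summit.Ventures.HodgeRepro2.T6.A3Bridge

open WeilPlanes WeilIntegral WeilDetect A3IntegralModel A3Detect A3Model A3Main A1Monomials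
  A1Complex

variable {K : Type*} [Field K] [NumberField K]

/-! ## 1. Coordinates of a degree-`n` element vanish off the `n`-sets -/

section Degree

variable (ι : Type*) [DecidableEq ι] [Fintype ι]

omit [DecidableEq ι] in
/-- An element of `⋀^n` of the model has monomial coordinates supported on the `n`-subsets. -/
theorem repr_eq_zero_of_card_ne {n : ℕ} {x : A ι} (hx : x ∈ ⋀[ℂ]^n (V ι))
    (t : Finset (Fin (Fintype.card (Gen ι)))) (ht : t.card ≠ n) : (monoBasis ι).repr x t = 0 := by
  -- expand `x` in the degree-`n` basis and read the full-basis coordinates off that expansion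
  set b := (genBasis ι).exteriorPower n
  have hsum := b.sum_repr ⟨x, hx⟩
  have hx' : x = ∑ s : Set.powersetCard (Fin (Fintype.card (Gen ι))) n,
      b.repr ⟨x, hx⟩ s • monoBasis ι s.val := by
    have := congrArg Subtype.val hsum
    rw [Submodule.coe_sum] at this
    simp only [Submodule.coe_smul] at this
    refine this.symm.trans (Finset.sum_congr rfl fun s _ => ?_)
    unfold monoBasis
    rw [ExteriorAlgebra.basis_eq_coe_basis]
  -- the same sum as a sum over all finsets with a coefficient function vanishing off the n-sets
  let c : Finset (Fin (Fintype.card (Gen ι))) → ℂ := fun u =>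
    if h : u.card = n then b.repr ⟨x, hx⟩ (Set.powersetCard.ofCard h) else 0
  have hx'' : x = ∑ u, c u • monoBasis ι u := by
    rw [hx']
    symm
    rw [← Finset.sum_filter_add_sum_filter_not Finset.univ (fun u => u.card = n)]
    have hzero : ∑ u ∈ Finset.univ.filter (fun u => ¬ u.card = n), c u • monoBasis ι u = 0 := by
      refine Finset.sum_eq_zero fun u hu => ?_
      have hu' : ¬ u.card = n := (Finset.mem_filter.mp hu).2
      simp only [c, dif_neg hu', zero_smul]
    rw [hzero, add_zero]
    rw [Finset.sum_subtype (Finset.univ.filter (fun u : Finset (Fin (Fintype.card (Gen ι))) => u.card = n))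
      (p := fun u => u ∈ Set.powersetCard (Fin (Fintype.card (Gen ι))) n)
      (fun u => by simp [Set.powersetCard.mem_iff])]
    refine Finset.sum_congr rfl fun s _ => ?_
    have hs : s.val.card = n := s.2
    simp only [c, dif_pos hs]
    rfl
  have hrepr : ⇑((monoBasis ι).repr x) = c := by
    rw [hx'']
    exact (monoBasis ι).repr_sum_self c
  rw [hrepr]
  simp only [c, dif_neg ht]

end Degree

/-! ## 2. Model monomials lie in the pieces of their type counts -/

variable (E : EigenBasis K)

/-- The embedding (the σ-label) of a generator `((i, ν), s)` of the model: `emb (ν, s)`. -/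
def label (j : Gen Pl) : K →+* ℂ := E.emb (j.1.2, j.2)

/-- The generators of a set `t` of cardinality `n`, enumerated in order:
`genEnum⁻¹ (t.orderEmbOfFin h i)`. -/
noncomputable def gens (t : Finset (Fin (Fintype.card (Gen Pl)))) {n : ℕ} (h : t.card = n) :
    Fin n → Gen Pl :=
  fun i => (genEnum Pl).symm (t.orderEmbOfFin h i)

/-- `k ∈ t ↔ genEnum⁻¹ k` is one of the generators `gens t h i`. -/
theorem mem_iff_exists_gens (t : Finset (Fin (Fintype.card (Gen Pl)))) {n : ℕ} (h : t.card = n)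
    (k : Fin (Fintype.card (Gen Pl))) : k ∈ t ↔ ∃ i, gens t h i = (genEnum Pl).symm k := by
  unfold gens
  constructor
  · intro hk
    have : k ∈ Set.range (t.orderEmbOfFin h) := by rw [Finset.range_orderEmbOfFin]; exact hk
    obtain ⟨i, hi⟩ := this
    exact ⟨i, by rw [hi]⟩
  · rintro ⟨i, hi⟩
    have := (genEnum Pl).symm.injective hi
    rw [← this]
    exact t.orderEmbOfFin_mem h i

/-- `monoBasis t = ιMulti (Pi.single (gens t h i) 1)_i`. -/
theorem monoBasis_eq_ιMulti (t : Finset (Fin (Fintype.card (Gen Pl)))) {n : ℕ} (h : t.card = n) :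
    monoBasis Pl t = ExteriorAlgebra.ιMulti ℂ n (fun i => (Pi.single (gens t h i) 1 : V Pl)) := by
  unfold monoBasis
  rw [ExteriorAlgebra.basis_apply_ofCard (genBasis Pl) h, ExteriorAlgebra.ιMulti_family]
  congr 1
  funext i
  simp only [Function.comp_apply, Set.powersetCard.ofFinEmbEquiv_symm_apply]
  rw [genBasis, Module.Basis.reindex_apply, Pi.basisFun_apply]
  rfl

/-- `Φ (monoBasis t) = ιMulti (eB (genIdx (gens t h i)))_i`: a wedge product of eigenvectors. -/
theorem modelEquiv_monoBasis (t : Finset (Fin (Fintype.card (Gen Pl)))) {n : ℕ} (h : t.card = n) :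
    modelEquiv E (monoBasis Pl t) =
      ExteriorAlgebra.ιMulti ℂ n (fun i => E.eB (genIdx E (gens t h i))) := by
  rw [monoBasis_eq_ιMulti t h, modelEquiv_ιMulti]
  congr 1
  funext i
  rw [eigenEquiv_single]

/-- `eB (i, σ)` lies in the eigenspace of σ (`eigenLine K i σ ≤ eigenSpace K σ`). -/
theorem eB_mem_eigenSpace (i : Fin 4) (σ : K →+* ℂ) : E.eB (i, σ) ∈ eigenSpace K σ := by
  have h : E.eB (i, σ) ∈ eigenLine K i σ := by
    rw [E.eigen i σ]
    exact Submodule.subset_span rfl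
  exact (le_iSup (fun i => eigenLine K i σ) i) h

/-- `Φ (monoBasis t)` has degree `n = |t|`. -/
theorem modelEquiv_monoBasis_mem (t : Finset (Fin (Fintype.card (Gen Pl)))) {n : ℕ}
    (h : t.card = n) : modelEquiv E (monoBasis Pl t) ∈ ⋀[ℂ]^n (H1C K) := by
  rw [modelEquiv_monoBasis E t h]
  exact ExteriorAlgebra.ιMulti_range ℂ n ⟨_, rfl⟩

/-- `Φ (monoBasis t)` lies in the piece of `⋀^n` of the type count of the labels of `t`. -/
theorem modelEquiv_monoBasis_mem_piece [DecidableEq (K →+* ℂ)]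
    (t : Finset (Fin (Fintype.card (Gen Pl)))) {n : ℕ} (h : t.card = n) :
    (⟨modelEquiv E (monoBasis Pl t), modelEquiv_monoBasis_mem E t h⟩ : ⋀[ℂ]^n (H1C K)) ∈
      piece (eigenSpace K) n (typeCount fun i => label E (gens t h i)) := by
  apply Submodule.subset_span
  refine ⟨fun i => E.eB (genIdx E (gens t h i)), fun i => label E (gens t h i), ?_, rfl, ?_⟩
  · intro i
    exact eB_mem_eigenSpace E _ _
  · apply Subtype.ext
    rw [exteriorPower.ιMulti_apply_coe]
    exact (modelEquiv_monoBasis E t h).symm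

/-! ## 3. The type count of a 4-set is `4e_ρ` exactly on the Weil index sets -/

/-- The type count of the labels of `t` as a `Fin 5`-valued function (each count is at most 4). -/
noncomputable def kOf [DecidableEq (K →+* ℂ)] (t : Finset (Fin (Fintype.card (Gen Pl))))
    (h : t.card = 4) : (K →+* ℂ) → Fin 5 :=
  fun ρ => ⟨typeCount (fun i => label E (gens t h i)) ρ, by
    unfold typeCount
    exact Nat.lt_succ_of_le (le_trans (Finset.card_le_univ _) (by simp))⟩

/-- `↑(kOf t h ρ) = typeCount … ρ`. -/
theorem coe_kOf [DecidableEq (K →+* ℂ)] (t : Finset (Fin (Fintype.card (Gen Pl)))) (h : t.card = 4)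
    (ρ : K →+* ℂ) : ((kOf E t h ρ : Fin 5) : ℕ) = typeCount (fun i => label E (gens t h i)) ρ := rfl

/-- All four labels of `t` are `ρ` iff `t` is the Weil index set of `emb⁻¹ ρ`. -/
theorem forall_label_eq_iff (t : Finset (Fin (Fintype.card (Gen Pl)))) (h : t.card = 4)
    (ρ : K →+* ℂ) :
    (∀ i, label E (gens t h i) = ρ) ↔ t = weilIdx (planes (E.emb.symm ρ).1) (E.emb.symm ρ).2 := by
  constructor
  · intro hall
    -- `t ⊆ weilIdx …`, both of cardinality 4
    refine Finset.eq_of_subset_of_card_le ?_ ?_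
    · intro k hk
      obtain ⟨i, hi⟩ := (mem_iff_exists_gens t h k).mp hk
      rw [mem_weilIdx, ← hi]
      have hl := hall i
      unfold label at hl
      have hνs : ((gens t h i).1.2, (gens t h i).2) = E.emb.symm ρ := by
        rw [← hl, Equiv.symm_apply_apply]
      have hν : (gens t h i).1.2 = (E.emb.symm ρ).1 := (Prod.mk.inj hνs).1
      have hs : (gens t h i).2 = (E.emb.symm ρ).2 := (Prod.mk.inj hνs).2
      unfold weilList
      refine List.mem_map.mpr ⟨(gens t h i).1, Finset.mem_toList.mpr ?_, ?_⟩
      · rw [mem_planes]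
        exact hν
      · rw [Prod.ext_iff]
        exact ⟨rfl, hs.symm⟩
    · rw [card_weilIdx, card_planes, h]
  · intro ht i
    have hk : t.orderEmbOfFin h i ∈ weilIdx (planes (E.emb.symm ρ).1) (E.emb.symm ρ).2 :=
      ht ▸ t.orderEmbOfFin_mem h i
    rw [mem_weilIdx] at hk
    change gens t h i ∈ weilList _ _ at hk
    unfold weilList at hk
    obtain ⟨p, hp, hpi⟩ := List.mem_map.mp hk
    rw [Finset.mem_toList, mem_planes] at hp
    unfold label
    rw [← hpi]
    change E.emb (p.2, (E.emb.symm ρ).2) = ρ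
    rw [hp, Prod.mk.eta, Equiv.apply_symm_apply]

/-- `∃ ρ, kOf t h = weilIdxC K 4 ρ` (the type count is `4e_ρ`) iff `t ∈ weilSet`. -/
theorem exists_kOf_eq_weilIdxC_iff [DecidableEq (K →+* ℂ)]
    (t : Finset (Fin (Fintype.card (Gen Pl)))) (h : t.card = 4) :
    (∃ ρ, kOf E t h = weilIdxC K 4 ρ) ↔ t ∈ weilSet := by
  constructor
  · rintro ⟨ρ, hρ⟩
    -- the count at ρ is 4 = all four labels are ρ
    have h4 : typeCount (fun i => label E (gens t h i)) ρ = 4 := by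
      have := congrArg (fun f => ((f ρ : Fin 5) : ℕ)) hρ
      simp only [coe_kOf, weilIdxC, Pi.single_eq_same, Fin.val_last] at this
      exact this
    have hall : ∀ i, label E (gens t h i) = ρ := by
      unfold typeCount at h4
      have hfull : (Finset.univ.filter fun i : Fin 4 => label E (gens t h i) = ρ) = Finset.univ :=
        Finset.eq_univ_of_card _ (by rw [h4, Fintype.card_fin])
      intro i
      have := Finset.mem_univ i
      rw [← hfull, Finset.mem_filter] at this
      exact this.2
    rw [forall_label_eq_iff E t h ρ] at hall
    rw [hall]
    exact weilIdx_mem_weilSet _ _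
  · intro ht
    obtain ⟨⟨ν, s⟩, _, hνs⟩ := Finset.mem_image.mp ht
    refine ⟨E.emb (ν, s), ?_⟩
    have hall : ∀ i, label E (gens t h i) = E.emb (ν, s) := by
      rw [forall_label_eq_iff, Equiv.symm_apply_apply]
      exact hνs.symm
    funext ρ
    apply Fin.ext
    rw [coe_kOf]
    unfold typeCount weilIdxC
    by_cases hρ : ρ = E.emb (ν, s)
    · subst hρ
      rw [Pi.single_eq_same, Fin.val_last]
      have : (Finset.univ.filter fun i : Fin 4 => label E (gens t h i) = E.emb (ν, s)) =
          Finset.univ := Finset.filter_true_of_mem fun i _ => hall i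
      rw [this, Finset.card_univ, Fintype.card_fin]
    · rw [Pi.single_eq_of_ne hρ, Fin.val_zero]
      have : (Finset.univ.filter fun i : Fin 4 => label E (gens t h i) = ρ) = ∅ := by
        apply Finset.filter_eq_empty_iff.mpr
        intro i _ hi
        exact hρ (hi ▸ hall i)
      rw [this, Finset.card_empty]

/-! ## 4. The bridge: A1's `eC` is the model Weil projector on `⋀⁴` -/

variable [IsGalois ℚ K] [DecidableEq (K →+* ℂ)] [DecidableEq (K →ₐ[ℚ] K)] [DecidableEq K]

/-- On a basis monomial of degree 4, `eC` keeps it iff it is a Weil monomial. -/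
theorem eC_modelEquiv_monoBasis (P : A1ProjData.WeilProjData K 4)
    (t : Finset (Fin (Fintype.card (Gen Pl)))) (h : t.card = 4) :
    eC K P (modelEquiv E (monoBasis Pl t)) =
      if t ∈ weilSet then modelEquiv E (monoBasis Pl t) else 0 := by
  have hmem : (⟨modelEquiv E (monoBasis Pl t), modelEquiv_monoBasis_mem E t h⟩ : ⋀[ℂ]^4 (H1C K)) ∈
      piece (eigenSpace K) 4 fun ρ => ((kOf E t h ρ : Fin 5) : ℕ) := by
    have := modelEquiv_monoBasis_mem_piece E t h
    convert this using 2
    exact funext fun ρ => rfl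
  have := eC_coe_of_mem_piece K P (kOf E t h) hmem
  simp only at this
  rw [this]
  by_cases hw : t ∈ weilSet
  · have h' : ∃ ρ, kOf E t h = weilIdxC K 4 ρ := (exists_kOf_eq_weilIdxC_iff E t h).mpr hw
    rw [if_pos h', if_pos hw, one_smul]
  · have h' : ¬ ∃ ρ, kOf E t h = weilIdxC K 4 ρ :=
      fun h' => hw ((exists_kOf_eq_weilIdxC_iff E t h).mp h')
    rw [if_neg h', if_neg hw, zero_smul]

/-- **The bridge:** on `⋀⁴`, A1's complex Weil projector `eC` is, through the eigenbasis model, the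
model Weil projector `modelWeilProj weilSet`. -/
theorem eC_modelEquiv (P : A1ProjData.WeilProjData K 4) {x : A Pl} (hx : x ∈ ⋀[ℂ]^4 (V Pl)) :
    eC K P (modelEquiv E x) = modelEquiv E (modelWeilProj weilSet x) := by
  conv_lhs => rw [← (monoBasis Pl).sum_repr x]
  rw [map_sum, map_sum, weilProj_apply, map_sum]
  have hterm : ∀ t : Finset (Fin (Fintype.card (Gen Pl))),
      eC K P (modelEquiv E ((monoBasis Pl).repr x t • monoBasis Pl t)) =
        if t ∈ weilSet then modelEquiv E ((monoBasis Pl).repr x t • monoBasis Pl t) else 0 := by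
    intro t
    by_cases h : t.card = 4
    · rw [map_smul, map_smul, eC_modelEquiv_monoBasis E P t h]
      split_ifs <;> simp
    · rw [repr_eq_zero_of_card_ne Pl hx t h, zero_smul, map_zero, map_zero]
      split_ifs <;> simp
  simp_rw [hterm]
  rw [Finset.sum_ite_mem, Finset.univ_inter]

/-- **`A3_main`'s binder `hpW_C` for A1's projector:** on `H⁴(B, ℚ)`, the complex form of A1's `pW`
is the model Weil projector. -/
theorem hpW_C_of_A1 (P : A1ProjData.WeilProjData K 4) :
    ∀ v ∈ degB K 4, extC K (pW K P v) =
      modelEquiv E (modelWeilProj weilSet ((modelEquiv E).symm (extC K v))) := by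
  intro v hv
  rw [← eC_extC K P v]
  have hx : (modelEquiv E).symm (extC K v) ∈ ⋀[ℂ]^4 (V Pl) :=
    modelEquiv_symm_mem_exteriorPower E 4 _ (extC_mem_exteriorPower hv)
  rw [← eC_modelEquiv E P hx, AlgEquiv.apply_symm_apply]

end Summit.Ventures.HodgeRepro2.T6.A3Bridge
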